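import Summits.KontsevichZagierPeriods.KontsevichZagierPeriods.Theorems.HurwitzMicroSectorsNormalFormPrincipleLevelTwoOdd
import Summits.KontsevichZagierPeriods.KontsevichZagierPeriods.Theorems.HurwitzMicroSectorsNormalFormPrincipleLevelTwoSquares
import Summits.KontsevichZagierPeriods.KontsevichZagierPeriods.Theorems.HurwitzMicroSectorsNormalFormPrincipleAlgLevelOneReduction

/-!
# `NormalFormPrinciple` (stmt-KontsevichZagierPeriods-3869), line `SketchIdeator1` — leaf `stub_boxRigidity`:
# LEVEL TWO WITH REAL-ALGEBRAIC COEFFICIENTS: the even part — reduction to `[(0,1)², β/(1−xy)] + [pt, q]`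

The EVEN part of the level-two layer `[(0,1)², P/(1 − x²y²)]`, `P ∈ (ℚ̄ ∩ ℝ)[x,y]` with monomials of
even total degree only (`P(−x,−y) = P(x,y)`; it contains the algebraic level-one boxes
`Q/(1 − xy) = Q(1+xy)/(1 − x²y²)` and the alternating boxes `Q/(1 + xy) = Q(1−xy)/(1 − x²y²)`,
e.g. `∫∫ dxdy/(1−x²y²) = π²/8`, `∫∫ dxdy/(1+xy) = π²/12`). Every even monomial box reduces inside
`FormalRep ⧸ relations`, by the Kontsevich–Zagier rules only, to the normal form
`[(0,1)², β/(1−xy)] + [pt, q]` with `β, q` real algebraic (`levelTwo_normalForm_even`):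
off the diagonal (`a ≠ b`, `a ≡ b (mod 2)`) merge → triangle → dimension one with an EVEN number
of terms, a polynomial box, an algebraic point (`even_offdiag_normalForm`); on the odd diagonal the
squares substitution `(x,y) ↦ (x²,y²)` (`levelTwo_squares`, rule 2) lands in the algebraic level-one
layer of `…AlgLevelOneReduction`; on the even diagonal `t^{k+1}/(1−t) = t^k/(1−t) − t^k`, `t = x²y²`,
and the base `c/(1−x²y²) = c/(1−xy) − c·xy/(1−x²y²)` with `[c·xy/(1−x²y²)] ≡ [(c/4)/(1−uv)]`
(`even_diag_normalForm`). [cite: KontsevichZagier2001, §1.2] No new definitions.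
-/

noncomputable section

open MeasureTheory Set
open Literature.NumberTheory.Transcendental Literature.NumberTheory.Transcendental.KZ
open Literature.ModelTheory.ExponentialFields (IsSemialgebraic)

namespace Summit.KontsevichZagierPeriods.HurwitzMicroSectors.NormalFormPrinciple.PiBox.AlgLevelTwo

open Summit.KontsevichZagierPeriods.HurwitzMicroSectors.NormalFormPrinciple.PiBox.Dlog
  (pt_zero_mem_relations pt_congr_mem_relations exists_ptCarrierA)
open Summit.KontsevichZagierPeriods.HurwitzMicroSectors.NormalFormPrinciple.PiBox.LevelOne
  (one_sub_mul_pos_of_mem_box)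
open Summit.KontsevichZagierPeriods.HurwitzMicroSectors.NormalFormPrinciple.PiBox.AlgLevelOne
  (alg_exists_reps alg_rigid_kit alg_monomials_to_points alg_monomial_normalForm alg_levelOne_normalForm
    isAlgebraic_ratCast_mul isAlgebraic_add' isAlgebraic_neg' zetaBoxA_zero_mem_relations
    mvPolynomial_eval_eq_sum_two)

/-- `c/4` is algebraic when `c` is. [folklore] -/
theorem isAlgebraic_div_four {c : ℝ} (hc : IsAlgebraic ℚ c) : IsAlgebraic ℚ (c / 4) := by
  have h := isAlgebraic_ratCast_mul hc (1 / 4)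
  have e : c / 4 = ((1 / 4 : ℚ) : ℝ) * c := by push_cast; ring
  rwa [e]

/-- Differences of real-algebraic numbers are real-algebraic. [folklore] -/
theorem isAlgebraic_sub' {c d : ℝ} (hc : IsAlgebraic ℚ c) (hd : IsAlgebraic ℚ d) : IsAlgebraic ℚ (c - d) :=
  isAlgebraic_iff_isIntegral.2 ((isAlgebraic_iff_isIntegral.1 hc).sub (isAlgebraic_iff_isIntegral.1 hd))

/-- **Even part, off the diagonal**: for `b < a` with `a − b` even the monomial box
`[(0,1)², c x^a y^b/(1 − x²y²)]` is an algebraic POINT (merge → triangle → dimension one with an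
even number of terms → polynomial → point). [cite: KontsevichZagier2001, §1.2] -/
theorem even_offdiag_normalForm (c : ℝ) (hc : IsAlgebraic ℚ c) (a b : ℕ) (hab : b < a)
    (hev : Even (a - b)) (N : IntegralRep 2) (hNd : N.domain = {x | ∀ i, x i ∈ Set.Ioo (0:ℝ) 1})
    (hNi : EqOn N.integrand (fun x => c * (x 0 ^ a * x 1 ^ b) / (1 - x 0 ^ 2 * x 1 ^ 2)) N.domain) :
    ∃ β q : ℝ, IsAlgebraic ℚ β ∧ IsAlgebraic ℚ q ∧ ∀ (B : IntegralRep 2) (Z : IntegralRep 0),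
      B.domain = {x | ∀ i, x i ∈ Set.Ioo (0:ℝ) 1} →
      EqOn B.integrand (fun x => β / (1 - x 0 * x 1)) B.domain →
      Z.domain = Set.univ → (Z.integrand = fun _ => q) → of N - of B - of Z ∈ relations := by
  obtain ⟨-, hexR, hexN₁⟩ := levelTwo_exists_reps c hc
  obtain ⟨R, hRd, hRi⟩ := hexR a b hab
  obtain ⟨N₁, hN₁d, hN₁i⟩ := hexN₁ b (a - b)
  have e1 := (levelTwo_merge_and_swap a b c hc).1 hab N R hNd hNi hRd (hRi ▸ fun _ _ => rfl)
  have e2 := levelTwo_triangle_sub_dimOne a b c hc hab R N₁ hRd (hRi ▸ fun _ _ => rfl) hN₁d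
    (hN₁i ▸ fun _ _ => rfl)
  obtain ⟨m, hm⟩ := hev
  have hm2 : a - b = 2 * m := by omega
  have hmpos : 0 < m := by omega
  have hN₁i' : EqOn N₁.integrand (fun x => c / ((2 * m : ℕ) : ℝ) *
      (x 0 ^ b * ∑ i ∈ Finset.range (2 * m), x 0 ^ i) / (1 + x 0)) N₁.domain := by
    rw [hN₁i, ← hm2]
    exact fun _ _ => rfl
  obtain ⟨q, hq, h3⟩ := (levelTwo_dimOne_normalForm c hc).2 b m hmpos N₁ hN₁d hN₁i'
  refine ⟨0, q, isAlgebraic_zero, hq, fun B Z _ hBi hZd hZi => ?_⟩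
  have e3 := h3 Z hZd hZi
  have eB := zetaBoxA_zero_mem_relations B hBi
  have e : of N - of B - of Z = (of N - of R) + (of R - of N₁) + (of N₁ - of Z) - of B := by abel
  rw [e]
  exact relations.sub_mem (relations.add_mem (relations.add_mem e1 e2) e3) eB

/-- **Even part, even diagonal** `[(0,1)², c (xy)^{2k}/(1 − x²y²)]`, by induction on `k`:
`t^{k+1}/(1−t) = t^k/(1−t) − t^k` (`t = x²y²`, each `c (xy)^{2k}` an algebraic point), and the base
`c/(1 − x²y²) = c/(1 − xy) − c·xy/(1 − x²y²)` with `[c·xy/(1−x²y²)] ≡ [(c/4)/(1−uv)]` by the squares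
substitution: normal form `[(0,1)², (c − c/4)/(1−xy)]`. [cite: KontsevichZagier2001, §1.2] -/
theorem even_diag_normalForm (c : ℝ) (hc : IsAlgebraic ℚ c) : ∀ (k : ℕ) (N : IntegralRep 2),
    N.domain = {x | ∀ i, x i ∈ Set.Ioo (0:ℝ) 1} →
    EqOn N.integrand (fun x => c * (x 0 ^ (2 * k) * x 1 ^ (2 * k)) / (1 - x 0 ^ 2 * x 1 ^ 2)) N.domain →
    ∃ β q : ℝ, IsAlgebraic ℚ β ∧ IsAlgebraic ℚ q ∧ ∀ (B : IntegralRep 2) (Z : IntegralRep 0),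
      B.domain = {x | ∀ i, x i ∈ Set.Ioo (0:ℝ) 1} →
      EqOn B.integrand (fun x => β / (1 - x 0 * x 1)) B.domain →
      Z.domain = Set.univ → (Z.integrand = fun _ => q) → of N - of B - of Z ∈ relations := by
  obtain ⟨hexN, -, -⟩ := levelTwo_exists_reps c hc
  obtain ⟨-, -, -, hBadd, hptadd, hexB⟩ := alg_rigid_kit
  obtain ⟨Zf, hZf⟩ := exists_ptCarrierA
  obtain ⟨-, hdiag⟩ := alg_monomials_to_points c hc
  have hc4 : IsAlgebraic ℚ (c / 4) := isAlgebraic_div_four hc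
  intro k
  induction k with
  | zero =>
    intro N hNd hNi
    obtain ⟨S, hSd, hSi⟩ := hexN 1 1
    obtain ⟨N', hN'd, hN'i⟩ := (alg_exists_reps (c / 4) hc4).1 0 0
    obtain ⟨Bc, hBcd, hBci⟩ := hexB c hc
    obtain ⟨B4, hB4d, hB4i⟩ := hexB (c / 4) hc4
    have eS : of S - of N' ∈ relations :=
      levelTwo_squares c hc 0 0 S N' hSd (fun x _ => by rw [hSi]) hN'd (hN'i ▸ fun _ _ => rfl)
    have eN' : of N' - of B4 ∈ relations :=
      of_sub_of_mem_relations_of_eqOn (hB4d.trans hN'd.symm) fun x hx => by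
        rw [hN'i, hB4i]
        simp
    have eadd : of Bc - of N - of S ∈ relations := by
      refine integrandAddRel_subset_relations ⟨2, Bc, N, S, hNd.trans hBcd.symm, hSd.trans hBcd.symm,
        fun x hx => ?_, rfl⟩
      rw [hBcd] at hx
      have h1 : (0:ℝ) < 1 - x 0 * x 1 := one_sub_mul_pos_of_mem_box hx
      have h2 : (0:ℝ) < 1 - x 0 ^ 2 * x 1 ^ 2 := one_sub_sq_mul_sq_pos_of_mem_box hx
      rw [Pi.add_apply, hBci, hNi (hNd ▸ hx), hSi]
      field_simp
      ring
    refine ⟨c - c / 4, 0, isAlgebraic_sub' hc hc4, isAlgebraic_zero, fun B Z hBd hBi _ hZi => ?_⟩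
    have eB := hBadd (c - c / 4) (c / 4) Bc B B4 hBcd (fun x _ => by rw [hBci]; ring_nf) hBd hBi hB4d
      (hB4i ▸ fun _ _ => rfl)
    have eZ := pt_zero_mem_relations Z hZi
    have e : of N - of B - of Z = -(of Bc - of N - of S) + (of Bc - of B - of B4) - (of S - of N')
        - (of N' - of B4) - of Z := by abel
    rw [e]
    exact relations.sub_mem (relations.sub_mem (relations.sub_mem (relations.add_mem
      (relations.neg_mem eadd) eB) eS) eN') eZ
  | succ k ih =>
    intro N hNd hNi
    obtain ⟨Nk, hNkd, hNki⟩ := hexN (2 * k) (2 * k)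
    obtain ⟨M, hMd, hMi⟩ := (alg_exists_reps c hc).2.2.2.1 (2 * k)
    have eadd : of Nk - of N - of M ∈ relations := by
      refine integrandAddRel_subset_relations ⟨2, Nk, N, M, hNd.trans hNkd.symm, hMd.trans hNkd.symm,
        fun x hx => ?_, rfl⟩
      rw [hNkd] at hx
      have h2 : (0:ℝ) < 1 - x 0 ^ 2 * x 1 ^ 2 := one_sub_sq_mul_sq_pos_of_mem_box hx
      rw [Pi.add_apply, hNki, hNi (hNd ▸ hx), hMi]
      field_simp
      ring
    obtain ⟨β, q, hβ, hq, h⟩ := ih Nk hNkd (hNki ▸ fun _ _ => rfl)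
    have hr : IsAlgebraic ℚ (c / (((2 * k + 1) ^ 2 : ℕ) : ℝ)) := by
      have e : c / (((2 * k + 1) ^ 2 : ℕ) : ℝ) = (((1 / ((2 * k + 1) ^ 2 : ℕ) : ℚ)) : ℝ) * c := by
        push_cast; ring
      rw [e]; exact isAlgebraic_ratCast_mul hc _
    refine ⟨β, q - c / (((2 * k + 1) ^ 2 : ℕ) : ℝ), hβ, isAlgebraic_sub' hq hr,
      fun B Z hBd hBi hZd hZi => ?_⟩
    have eM := hdiag (2 * k) M (Zf (c / (((2 * k + 1) ^ 2 : ℕ) : ℝ))) hMd (hMi ▸ fun _ _ => rfl)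
      (hZf _ hr).1 (hZf _ hr).2
    have e1 := h B (Zf q) hBd hBi (hZf q hq).1 (hZf q hq).2
    have eZ := hptadd (q - c / (((2 * k + 1) ^ 2 : ℕ) : ℝ)) (c / (((2 * k + 1) ^ 2 : ℕ) : ℝ)) (Zf q) Z
      (Zf (c / (((2 * k + 1) ^ 2 : ℕ) : ℝ))) (hZf q hq).1 (by rw [(hZf q hq).2]; funext; ring) hZd hZi
      (hZf _ hr).1 (hZf _ hr).2
    have e : of N - of B - of Z = -(of Nk - of N - of M) + (of Nk - of B - of (Zf q))
        - (of M - of (Zf (c / (((2 * k + 1) ^ 2 : ℕ) : ℝ))))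
        + (of (Zf q) - of Z - of (Zf (c / (((2 * k + 1) ^ 2 : ℕ) : ℝ)))) := by abel
    rw [e]
    exact relations.add_mem (relations.sub_mem (relations.add_mem (relations.neg_mem eadd) e1) eM) eZ

/-- **Even part, `b ≤ a`.** [cite: KontsevichZagier2001, §1.2] -/
theorem levelTwo_monomial_normalForm_even_of_le (c : ℝ) (hc : IsAlgebraic ℚ c) (a b : ℕ) (hba : b ≤ a)
    (hev : Even (a + b)) (N : IntegralRep 2) (hNd : N.domain = {x | ∀ i, x i ∈ Set.Ioo (0:ℝ) 1})
    (hNi : EqOn N.integrand (fun x => c * (x 0 ^ a * x 1 ^ b) / (1 - x 0 ^ 2 * x 1 ^ 2)) N.domain) :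
    ∃ β q : ℝ, IsAlgebraic ℚ β ∧ IsAlgebraic ℚ q ∧ ∀ (B : IntegralRep 2) (Z : IntegralRep 0),
      B.domain = {x | ∀ i, x i ∈ Set.Ioo (0:ℝ) 1} →
      EqOn B.integrand (fun x => β / (1 - x 0 * x 1)) B.domain →
      Z.domain = Set.univ → (Z.integrand = fun _ => q) → of N - of B - of Z ∈ relations := by
  have hc4 : IsAlgebraic ℚ (c / 4) := isAlgebraic_div_four hc
  rcases hba.lt_or_eq with hab | rfl
  · have hev' : Even (a - b) := by
      obtain ⟨m, hm⟩ := hev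
      exact ⟨m - b, by omega⟩
    exact even_offdiag_normalForm c hc a b hab hev' N hNd hNi
  · rcases Nat.even_or_odd b with ⟨k, hk⟩ | ⟨k, hk⟩
    · have hk2 : b = 2 * k := by omega
      subst hk2
      exact even_diag_normalForm c hc k N hNd hNi
    · subst hk
      obtain ⟨N', hN'd, hN'i⟩ := (alg_exists_reps (c / 4) hc4).1 k k
      have eS := levelTwo_squares c hc k k N N' hNd hNi hN'd (hN'i ▸ fun _ _ => rfl)
      obtain ⟨β, q, hβ, hq, h⟩ := alg_monomial_normalForm (c / 4) hc4 k k N' hN'd (hN'i ▸ fun _ _ => rfl)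
      refine ⟨β, q, hβ, hq, fun B Z hBd hBi hZd hZi => ?_⟩
      have e : of N - of B - of Z = (of N - of N') + (of N' - of B - of Z) := by abel
      rw [e]
      exact relations.add_mem eS (h B Z hBd hBi hZd hZi)

/-- **Normal form of an EVEN monomial box `[(0,1)², c x^a y^b/(1 − x²y²)]`, `a ≡ b (mod 2)`, with an
algebraic coefficient**: `[(0,1)², β/(1−xy)] + [pt, q]`, `β, q ∈ ℚ̄ ∩ ℝ`. [cite: KontsevichZagier2001, §1.2] -/
theorem levelTwo_monomial_normalForm_even (c : ℝ) (hc : IsAlgebraic ℚ c) (a b : ℕ) (hev : Even (a + b))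
    (N : IntegralRep 2) (hNd : N.domain = {x | ∀ i, x i ∈ Set.Ioo (0:ℝ) 1})
    (hNi : EqOn N.integrand (fun x => c * (x 0 ^ a * x 1 ^ b) / (1 - x 0 ^ 2 * x 1 ^ 2)) N.domain) :
    ∃ β q : ℝ, IsAlgebraic ℚ β ∧ IsAlgebraic ℚ q ∧ ∀ (B : IntegralRep 2) (Z : IntegralRep 0),
      B.domain = {x | ∀ i, x i ∈ Set.Ioo (0:ℝ) 1} →
      EqOn B.integrand (fun x => β / (1 - x 0 * x 1)) B.domain →
      Z.domain = Set.univ → (Z.integrand = fun _ => q) → of N - of B - of Z ∈ relations := by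
  rcases le_or_gt b a with hba | hab
  · exact levelTwo_monomial_normalForm_even_of_le c hc a b hba hev N hNd hNi
  · obtain ⟨hexN, -, -⟩ := levelTwo_exists_reps c hc
    obtain ⟨N', hN'd, hN'i⟩ := hexN b a
    have e0 := (levelTwo_merge_and_swap a b c hc).2 N N' hNd hNi hN'd (hN'i ▸ fun _ _ => rfl)
    obtain ⟨β, q, hβ, hq, h⟩ := levelTwo_monomial_normalForm_even_of_le c hc b a hab.le
      (by rwa [add_comm]) N' hN'd (hN'i ▸ fun _ _ => rfl)
    refine ⟨β, q, hβ, hq, fun B Z hBd hBi hZd hZi => ?_⟩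
    have e : of N - of B - of Z = (of N - of N') + (of N' - of B - of Z) := by abel
    rw [e]
    exact relations.add_mem e0 (h B Z hBd hBi hZd hZi)

/-- **Even sums**: reduction of `[(0,1)², (Σ_{s∈S} c_s x^s)/(1 − x²y²)]`, all `s₀ + s₁` even, to the
normal form `[(0,1)², β/(1−xy)] + [pt, q]`. [cite: KontsevichZagier2001, §1.2] -/
theorem even_sum_normalForm (coef : (Fin 2 →₀ ℕ) → ℝ) : ∀ (S : Finset (Fin 2 →₀ ℕ)),
    (∀ s ∈ S, IsAlgebraic ℚ (coef s)) → (∀ s ∈ S, Even (s 0 + s 1)) → ∀ (N : IntegralRep 2),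
    N.domain = {x | ∀ i, x i ∈ Set.Ioo (0:ℝ) 1} →
    EqOn N.integrand
      (fun x => (∑ s ∈ S, coef s * (x 0 ^ (s 0) * x 1 ^ (s 1))) / (1 - x 0 ^ 2 * x 1 ^ 2)) N.domain →
    ∃ β q : ℝ, IsAlgebraic ℚ β ∧ IsAlgebraic ℚ q ∧ ∀ (B : IntegralRep 2) (Z : IntegralRep 0),
      B.domain = {x | ∀ i, x i ∈ Set.Ioo (0:ℝ) 1} →
      EqOn B.integrand (fun x => β / (1 - x 0 * x 1)) B.domain →
      Z.domain = Set.univ → (Z.integrand = fun _ => q) → of N - of B - of Z ∈ relations := by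
  classical
  obtain ⟨-, -, -, hBadd, hptadd, hexB⟩ := alg_rigid_kit
  obtain ⟨Zf, hZf⟩ := exists_ptCarrierA
  intro S
  induction S using Finset.induction_on with
  | empty =>
    intro _ _ N hNd hNi
    refine ⟨0, 0, isAlgebraic_zero, isAlgebraic_zero, fun B Z hBd hBi hZd hZi => ?_⟩
    have hN : of N ∈ relations := of_mem_relations_of_eqOn_zero N fun x hx => by rw [hNi hx]; simp
    have hB := zetaBoxA_zero_mem_relations B hBi
    have hZ := pt_zero_mem_relations Z hZi
    exact relations.sub_mem (relations.sub_mem hN hB) hZ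
  | insert s S hs ih =>
    intro halg hpar N hNd hNi
    have halgS : ∀ t ∈ S, IsAlgebraic ℚ (coef t) := fun t ht => halg t (Finset.mem_insert_of_mem ht)
    have hparS : ∀ t ∈ S, Even (t 0 + t 1) := fun t ht => hpar t (Finset.mem_insert_of_mem ht)
    have halgs : IsAlgebraic ℚ (coef s) := halg s (Finset.mem_insert_self s S)
    obtain ⟨N₁, hN₁d, hN₁i⟩ := exists_levelTwoRep S coef halgS
    obtain ⟨N₂, hN₂d, hN₂i⟩ := (levelTwo_exists_reps (coef s) halgs).1 (s 0) (s 1)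
    obtain ⟨β₁, q₁, hβ₁, hq₁, h₁⟩ := ih halgS hparS N₁ hN₁d (hN₁i ▸ fun _ _ => rfl)
    obtain ⟨β₂, q₂, hβ₂, hq₂, h₂⟩ := levelTwo_monomial_normalForm_even (coef s) halgs (s 0) (s 1)
      (hpar s (Finset.mem_insert_self s S)) N₂ hN₂d (hN₂i ▸ fun _ _ => rfl)
    refine ⟨β₁ + β₂, q₁ + q₂, isAlgebraic_add' hβ₁ hβ₂, isAlgebraic_add' hq₁ hq₂,
      fun B Z hBd hBi hZd hZi => ?_⟩
    obtain ⟨B₁, hB₁d, hB₁i⟩ := hexB β₁ hβ₁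
    obtain ⟨B₂, hB₂d, hB₂i⟩ := hexB β₂ hβ₂
    have eN : of N - of N₂ - of N₁ ∈ relations := by
      refine integrandAddRel_subset_relations ⟨2, N, N₂, N₁, hN₂d.trans hNd.symm, hN₁d.trans hNd.symm,
        fun x hx => ?_, rfl⟩
      rw [Pi.add_apply, hNi hx, hN₁i, hN₂i]
      simp only [Finset.sum_insert hs]
      ring
    have e₁ := h₁ B₁ (Zf q₁) hB₁d (hB₁i ▸ fun _ _ => rfl) (hZf q₁ hq₁).1 (hZf q₁ hq₁).2
    have e₂ := h₂ B₂ (Zf q₂) hB₂d (hB₂i ▸ fun _ _ => rfl) (hZf q₂ hq₂).1 (hZf q₂ hq₂).2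
    have eB := hBadd β₁ β₂ B B₁ B₂ hBd hBi hB₁d (hB₁i ▸ fun _ _ => rfl) hB₂d (hB₂i ▸ fun _ _ => rfl)
    have eZ := hptadd q₁ q₂ Z (Zf q₁) (Zf q₂) hZd hZi (hZf q₁ hq₁).1 (hZf q₁ hq₁).2 (hZf q₂ hq₂).1
      (hZf q₂ hq₂).2
    have e : of N - of B - of Z = (of N - of N₂ - of N₁) + (of N₁ - of B₁ - of (Zf q₁))
        + (of N₂ - of B₂ - of (Zf q₂)) - (of B - of B₁ - of B₂) - (of Z - of (Zf q₁) - of (Zf q₂)) := by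
      abel
    rw [e]
    exact relations.sub_mem (relations.sub_mem (relations.add_mem (relations.add_mem eN e₁) e₂) eB) eZ

/-- **Normal form of an even level-two box** `[(0,1)², P/(1 − x²y²)]`, `P ∈ (ℚ̄ ∩ ℝ)[x,y]` with only
monomials of even total degree (`P(−x,−y) = P(x,y)`). [cite: KontsevichZagier2001, §1.2] -/
theorem levelTwo_normalForm_even (P : MvPolynomial (Fin 2) ℝ) (hP : ∀ s, IsAlgebraic ℚ (P.coeff s))
    (hev : ∀ s ∈ P.support, Even (s 0 + s 1)) (N : IntegralRep 2)
    (hNd : N.domain = {x | ∀ i, x i ∈ Set.Ioo (0:ℝ) 1})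
    (hNi : EqOn N.integrand (fun x => MvPolynomial.eval x P / (1 - x 0 ^ 2 * x 1 ^ 2)) N.domain) :
    ∃ β q : ℝ, IsAlgebraic ℚ β ∧ IsAlgebraic ℚ q ∧ ∀ (B : IntegralRep 2) (Z : IntegralRep 0),
      B.domain = {x | ∀ i, x i ∈ Set.Ioo (0:ℝ) 1} →
      EqOn B.integrand (fun x => β / (1 - x 0 * x 1)) B.domain →
      Z.domain = Set.univ → (Z.integrand = fun _ => q) → of N - of B - of Z ∈ relations :=
  even_sum_normalForm P.coeff P.support (fun s _ => hP s) hev N hNd fun x hx => by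
    rw [hNi hx]
    beta_reduce
    rw [mvPolynomial_eval_eq_sum_two]

end Summit.KontsevichZagierPeriods.HurwitzMicroSectors.NormalFormPrinciple.PiBox.AlgLevelTwo
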